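import Summits.ResolutionOfSingularities.ResolutionOfSingularities.Theorems.FrobeniusClosingPatchingRelPerfectDepthParamLiftQuotient
import Literature.AlgebraicGeometry.Resolution.BoundaryRestriction
import HarnessLib

/-!
# Crux `PatchingRelPerfect` (stmt-ResolutionOfSingularities-16161), chain W5.2 — F7(β) (β-AX) X3 C-I (M2b-T) (T-c), piece 1:
# SNC LIFT from a regular hypersurface — traces snc on `V(G)` ⇒ `G :: 𝓛` snc at the points of `V(G)`

[OURS · L1 W5.2 · F7(β) (β-AX) X3 C-I (M2b-T) (T-c) · res-D-pv-034 AS res-L1-s36-pv-3 per DESK WORD 20:05:57Z (G12-29/G12-32).]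
Replaces the role of NO printed item; NOT a statement of the manuscript under review; fact-free, def-free.  AI-written; AI review
is weaker than expert review.

The converse of the tree's `hasSNC_filter_map_comap_subschemeι` (BoundaryRestriction.lean; Kollár 3.85 «`E|_H` is again a divisor
with simple normal crossings»): if the TRACES on a regular hypersurface `V(G)` of letters `𝓛` (principal stalks at the points of
`V(G)` they meet) form a simple normal crossings family on `V(G)`, then `G :: 𝓛` satisfies the simple normal crossings condition
AT EVERY POINT OF `V(G)`: lift the adapted regular system of parameters of `𝒪_{V(G),s} = 𝒪_{X,x}/(v)` choosing the letters'
generators as the lifts of their labels, and add `v` (Matsumura 14.2).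

* `exists_rsop_cons_of_quotient` — ring form;
* **`hasSNC_cons_at_of_traces`** — scheme form (the body of `HasSNC (G :: 𝓛)` at `x ∈ V(G)`).

## References
* H. Matsumura, *Commutative Ring Theory* (1986), Thm. 14.2. [Matsumura1987]
* J. Kollár, *Lectures on Resolution of Singularities* (2007), Cor. 3.85 (p. 158). [Kollar2007]
-/

-- `Summit.<Summit>.<Sub>.Theorems` with `Sub = Summit` (single-conjunct summit, D-0017)
set_option linter.dupNamespace false

noncomputable section

open CategoryTheory AlgebraicGeometry TopologicalSpace IsLocalRing
open Literature.AlgebraicGeometry.Resolution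
open Scheme.IdealSheafData

namespace Summit.ResolutionOfSingularities.ResolutionOfSingularities.Theorems.DepthMultiHost

universe u

/-! ## §1 Ring form -/

section Ring

variable {A B : Type u} [CommRing A] [CommRing B] [IsRegularLocalRing A] [IsRegularLocalRing B]

/-- **Lifting an adapted regular system of parameters through `A → A/(v)`.**  `q : A ↠ B` local surjection of regular local rings
with kernel `(v)`, `v ≠ 0`; `ū` a minimal basis of `𝔪_B` indexed by `Fin n`, `n = emb dim B`; prescribed lifts `f j` of the
labelled members `ū (ι j)` up to units (`(q (f j)) = (ū (ι j))`, `ι` injective).  Then `emb dim A = n + 1` and there is a minimal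
basis `U` of `𝔪_A` on `Fin (n + 1)` with `U 0 = v` and `U (ι j + 1) = f j`. [cite: Matsumura1987, Thm. 14.2] -/
theorem exists_rsop_cons_of_quotient (q : A →+* B) (hq : Function.Surjective q) {v : A} (hv : v ∈ maximalIdeal A) (hv0 : v ≠ 0)
    (hker : RingHom.ker q = Ideal.span {v}) {n : ℕ} (hn : (maximalIdeal B).spanFinrank = n) (ū : Fin n → B)
    (hū : Ideal.span (Set.range ū) = maximalIdeal B) {J : Type*} (f : J → A) (ι : J → Fin n) (hι : Function.Injective ι)
    (hf : ∀ j, Ideal.span {q (f j)} = Ideal.span {ū (ι j)}) :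
    (maximalIdeal A).spanFinrank = n + 1 ∧
      ∃ U : Fin (n + 1) → A, Ideal.span (Set.range U) = maximalIdeal A ∧ U 0 = v ∧ ∀ j, U (Fin.succ (ι j)) = f j := by
  classical
  -- `A/(v) ≅ B`, so `A/(v)` is regular and `emb dim A = emb dim B + 1`
  let e : A ⧸ Ideal.span {v} ≃+* B :=
    (Ideal.quotEquivOfEq hker.symm).trans (RingHom.quotientKerEquivOfSurjective hq)
  haveI : IsRegularLocalRing (A ⧸ Ideal.span {v}) := IsRegularLocalRing.of_ringEquiv e.symm
  have hsfr : (maximalIdeal A).spanFinrank = n + 1 := by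
    rw [spanFinrank_maximalIdeal_eq_quotient_add_one hv hv0, ← hn]
    congr 1
    -- `emb dim` is invariant under `e`
    have h1 := (IsRegularLocalRing.spanFinrank_maximalIdeal (R := A ⧸ Ideal.span {v}))
    have h2 := (IsRegularLocalRing.spanFinrank_maximalIdeal (R := B))
    have h3 := ringKrullDim_eq_of_ringEquiv e
    have h : ((maximalIdeal (A ⧸ Ideal.span {v})).spanFinrank : WithBot ℕ∞) = (maximalIdeal B).spanFinrank := by
      rw [h1, h2, h3]
    exact_mod_cast h
  refine ⟨hsfr, ?_⟩
  -- the lifts: the prescribed `f j` on labelled indices, any preimage elsewhere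
  let w : Fin n → A := fun i => if h : ∃ j, ι j = i then f h.choose else (hq (ū i)).choose
  have hwι : ∀ j, w (ι j) = f j := fun j => by
    have h : ∃ j', ι j' = ι j := ⟨j, rfl⟩
    simp only [w, dif_pos h]
    congr 1
    exact hι h.choose_spec
  have hqw : ∀ i, Ideal.span {q (w i)} = Ideal.span {ū i} := fun i => by
    by_cases h : ∃ j, ι j = i
    · obtain ⟨j, rfl⟩ := h
      rw [hwι, hf]
    · simp only [w, dif_neg h]
      rw [(hq (ū i)).choose_spec]
  refine ⟨Fin.cons v w, ?_, rfl, fun j => by simp [hwι]⟩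
  -- `span (v, w) = 𝔪_A`: it contains `ker q = (v)` and maps onto `𝔪_B`
  have hmapw : (Ideal.span (Set.range w)).map q = maximalIdeal B := by
    rw [Ideal.map_span, ← Set.range_comp, ← hū]
    apply le_antisymm
    · rw [Ideal.span_le]
      rintro _ ⟨i, rfl⟩
      have h : q (w i) ∈ Ideal.span {q (w i)} := Ideal.mem_span_singleton_self _
      rw [hqw] at h
      exact Ideal.span_mono (Set.singleton_subset_iff.mpr (Set.mem_range_self i)) h
    · rw [Ideal.span_le]
      rintro _ ⟨i, rfl⟩
      have h : ū i ∈ Ideal.span {ū i} := Ideal.mem_span_singleton_self _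
      rw [← hqw] at h
      exact Ideal.span_mono (Set.singleton_subset_iff.mpr (Set.mem_range_self (f := q ∘ w) i)) h
  have hcomap : (maximalIdeal B).comap q = maximalIdeal A := by
    haveI := Ideal.comap_isMaximal_of_surjective q hq (K := maximalIdeal B)
    exact IsLocalRing.eq_maximalIdeal inferInstance
  rw [Fin.range_cons, Ideal.span_insert, ← hcomap, ← hmapw, Ideal.comap_map_of_surjective q hq, ← RingHom.ker_eq_comap_bot,
    hker, sup_comm]

end Ring

/-! ## §2 Scheme form -/

variable {X : Scheme.{u}}

/-- [OURS · L1 W5.2 · (T-c) piece 1] **SNC LIFT FROM A REGULAR HYPERSURFACE, pointwise on `V(G)`.**  `X` regular locally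
Noetherian; `V(G)` a regular hypersurface (order-one principal stalks, the `hGhyp` binder of `carrierGameLift_of_ambientLetters`);
letters `𝓛` with principal stalks at the points of `V(G)` they meet, SEPARATED by their traces there
(`L_x + G_x = L′_x + G_x ⇒ L = L′`); the traces `𝓛.map (·|_{V(G)})` a simple normal crossings family ON `V(G)`.  Then the simple
normal crossings condition of `G :: 𝓛` holds at every point of `V(G)` (the body of `HasSNC (G :: 𝓛)` there).
[cite: Matsumura1987, Thm. 14.2] [cite: Kollar2007, Cor. 3.85] -/
theorem hasSNC_cons_at_of_traces (hX : Scheme.IsRegular X) (G : X.IdealSheafData)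
    (hGhyp : ∀ x ∈ G.support, ∃ v : X.presheaf.stalk x,
      stalkIdeal G x = Ideal.span {v} ∧ v ∉ (maximalIdeal (X.presheaf.stalk x)) ^ 2)
    (𝓛 : List X.IdealSheafData)
    (hL : ∀ L ∈ 𝓛, ∀ x ∈ G.support, x ∈ L.support → ∃ f : X.presheaf.stalk x, stalkIdeal L x = Ideal.span {f})
    (hsep : ∀ L ∈ 𝓛, ∀ L' ∈ 𝓛, ∀ x ∈ G.support, x ∈ L.support → x ∈ L'.support →
      stalkIdeal L x ⊔ stalkIdeal G x = stalkIdeal L' x ⊔ stalkIdeal G x → L = L')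
    (htr : HasSNC (𝓛.map fun L => L.comap G.subschemeι)) (x : X) (hx : x ∈ G.support) :
    IsRegularLocalRing (X.presheaf.stalk x) ∧
      ∃ u : Fin (maximalIdeal (X.presheaf.stalk x)).spanFinrank → X.presheaf.stalk x,
        Ideal.span (Set.range u) = maximalIdeal (X.presheaf.stalk x) ∧
        ∃ ι : {D // D ∈ G :: 𝓛 ∧ x ∈ D.support} → Fin (maximalIdeal (X.presheaf.stalk x)).spanFinrank,
          Function.Injective ι ∧ ∀ D, stalkIdeal D.1 x = Ideal.span {u (ι D)} := by
  classical
  haveI hA : IsRegularLocalRing (X.presheaf.stalk x) := hX x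
  -- the point `s` of `V(G)` over `x` and the surjection `q : 𝒪_{X,x} ↠ 𝒪_{V(G),s}` with kernel `(v)`
  obtain ⟨s, rfl⟩ : x ∈ Set.range G.subschemeι := by rw [range_subschemeι]; exact hx
  obtain ⟨v, hGv, hv2⟩ := hGhyp _ hx
  have hv : v ∈ maximalIdeal _ := by
    have h : stalkIdeal G (G.subschemeι s) ≤ maximalIdeal _ := (mem_support_iff_stalkIdeal_le _ _).mp hx
    exact h (hGv ▸ Ideal.mem_span_singleton_self v)
  have hv0 : v ≠ 0 := fun h => hv2 (h ▸ Ideal.zero_mem _)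
  set q := (G.subschemeι.stalkMap s).hom with hqdef
  have hq : Function.Surjective q := G.subschemeι.stalkMap_surjective s
  have hker : RingHom.ker q = Ideal.span {v} := by
    rw [hqdef, ker_stalkMap_of_isClosedImmersion G.subschemeι s, ker_subschemeι, hGv]
  -- the snc data of the traces at `s`
  obtain ⟨hB, ū, hū, ⟨ιB, hιBinj, hιB⟩, -⟩ := htr s
  haveI := hB
  have hmemtr : ∀ L : X.IdealSheafData, s ∈ (L.comap G.subschemeι).support ↔ G.subschemeι s ∈ L.support := fun L => by
    rw [support_comap]; rfl
  have htrace : ∀ L : X.IdealSheafData, stalkIdeal (L.comap G.subschemeι) s = (stalkIdeal L (G.subschemeι s)).map q := fun L =>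
    stalkIdeal_comap_eq_map_stalkMap _ _ _
  -- the letters through `x`, their generators and their labels
  let J := {L // L ∈ 𝓛 ∧ G.subschemeι s ∈ L.support}
  have hf := fun j : J => (hL j.1 j.2.1 _ hx j.2.2).choose_spec
  let f : J → X.presheaf.stalk (G.subschemeι s) := fun j => (hL j.1 j.2.1 _ hx j.2.2).choose
  have hfj : ∀ j : J, stalkIdeal j.1 (G.subschemeι s) = Ideal.span {f j} := hf
  let D' : J → {D' // D' ∈ 𝓛.map (fun L => L.comap G.subschemeι) ∧ s ∈ D'.support} := fun j =>
    ⟨j.1.comap G.subschemeι, List.mem_map.mpr ⟨j.1, j.2.1, rfl⟩, (hmemtr j.1).mpr j.2.2⟩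
  let ι : J → Fin (maximalIdeal ((G.subscheme).presheaf.stalk s)).spanFinrank := fun j => ιB (D' j)
  have hfι : ∀ j, Ideal.span {q (f j)} = Ideal.span {ū (ι j)} := fun j => by
    rw [← hιB (D' j), show (D' j).1 = j.1.comap G.subschemeι from rfl, htrace, hfj, Ideal.map_span, Set.image_singleton]
  have hιinj : Function.Injective ι := by
    intro j j' h
    have h1 : (D' j).1 = (D' j').1 := congrArg Subtype.val (hιBinj h)
    have h2 : stalkIdeal (j.1.comap G.subschemeι) s = stalkIdeal (j'.1.comap G.subschemeι) s := by
      show stalkIdeal (D' j).1 s = stalkIdeal (D' j').1 s; rw [h1]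
    rw [htrace, htrace] at h2
    have h3 := congrArg (Ideal.comap q) h2
    rw [Ideal.comap_map_of_surjective q hq, Ideal.comap_map_of_surjective q hq, ← RingHom.ker_eq_comap_bot, hker, ← hGv] at h3
    exact Subtype.ext (hsep j.1 j.2.1 j'.1 j'.2.1 _ hx j.2.2 j'.2.2 h3)
  -- lift
  obtain ⟨hsfr, U, hU, hU0, hUι⟩ := exists_rsop_cons_of_quotient q hq hv hv0 hker rfl ū hū f ι hιinj hfι
  refine ⟨hA, fun i => U (Fin.cast hsfr i), ?_, ?_⟩
  · have hr : (Set.range fun i => U (Fin.cast hsfr i)) = Set.range U := by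
      ext a
      constructor
      · rintro ⟨i, rfl⟩; exact ⟨_, rfl⟩
      · rintro ⟨i, rfl⟩; exact ⟨Fin.cast hsfr.symm i, by simp⟩
    rw [hr, hU]
  -- labels: `G ↦ 0`, `L ↦ ι L + 1`
  have hmem𝓛 : ∀ D : {D // D ∈ G :: 𝓛 ∧ G.subschemeι s ∈ D.support}, D.1 ≠ G → D.1 ∈ 𝓛 := fun D h =>
    (List.mem_cons.mp D.2.1).resolve_left h
  let lab : {D // D ∈ G :: 𝓛 ∧ G.subschemeι s ∈ D.support} → Fin ((maximalIdeal ((G.subscheme).presheaf.stalk s)).spanFinrank + 1) :=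
    fun D => if h : D.1 = G then 0 else Fin.succ (ι ⟨D.1, hmem𝓛 D h, D.2.2⟩)
  refine ⟨fun D => Fin.cast hsfr.symm (lab D), fun D₁ D₂ h => ?_, fun D => ?_⟩
  · have h' : lab D₁ = lab D₂ := by simpa using h
    by_cases h₁ : D₁.1 = G <;> by_cases h₂ : D₂.1 = G
    · exact Subtype.ext (h₁.trans h₂.symm)
    · simp only [lab, dif_pos h₁, dif_neg h₂] at h'; exact absurd h'.symm (Fin.succ_ne_zero _)
    · simp only [lab, dif_neg h₁, dif_pos h₂] at h'; exact absurd h' (Fin.succ_ne_zero _)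
    · simp only [lab, dif_neg h₁, dif_neg h₂, Fin.succ_inj] at h'
      exact Subtype.ext (congrArg (fun j : J => j.1) (hιinj h'))
  · by_cases h : D.1 = G
    · simp only [lab, dif_pos h, h, hGv, ← hU0]
      rfl
    · simp only [lab, dif_neg h]
      have hc : Fin.cast hsfr (Fin.cast hsfr.symm (Fin.succ (ι ⟨D.1, hmem𝓛 D h, D.2.2⟩))) =
          Fin.succ (ι ⟨D.1, hmem𝓛 D h, D.2.2⟩) := by
        ext; simp
      rw [hc, hUι]
      exact hfj ⟨D.1, hmem𝓛 D h, D.2.2⟩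

/-- [OURS · L1 W5.2 · (T-c) piece 2] **SNC LIFT, global form on a patch**: if moreover the letters `𝓛` satisfy the simple normal
crossings condition at every point OFF `V(G)` (on the patch `X` itself — restrict first), then `HasSNC (G :: 𝓛)` on `X`: the
`hsnc` binder of `carrierGameLift_of_ambientLetters`. [cite: Kollar2007, Cor. 3.85] -/
theorem hasSNC_cons_of_traces (hX : Scheme.IsRegular X) (G : X.IdealSheafData)
    (hGhyp : ∀ x ∈ G.support, ∃ v : X.presheaf.stalk x,
      stalkIdeal G x = Ideal.span {v} ∧ v ∉ (maximalIdeal (X.presheaf.stalk x)) ^ 2)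
    (𝓛 : List X.IdealSheafData)
    (hL : ∀ L ∈ 𝓛, ∀ x ∈ G.support, x ∈ L.support → ∃ f : X.presheaf.stalk x, stalkIdeal L x = Ideal.span {f})
    (hsep : ∀ L ∈ 𝓛, ∀ L' ∈ 𝓛, ∀ x ∈ G.support, x ∈ L.support → x ∈ L'.support →
      stalkIdeal L x ⊔ stalkIdeal G x = stalkIdeal L' x ⊔ stalkIdeal G x → L = L')
    (htr : HasSNC (𝓛.map fun L => L.comap G.subschemeι))
    (hoff : ∀ x ∉ G.support, IsRegularLocalRing (X.presheaf.stalk x) ∧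
      ∃ u : Fin (maximalIdeal (X.presheaf.stalk x)).spanFinrank → X.presheaf.stalk x,
        Ideal.span (Set.range u) = maximalIdeal (X.presheaf.stalk x) ∧
        ∃ ι : {D // D ∈ 𝓛 ∧ x ∈ D.support} → Fin (maximalIdeal (X.presheaf.stalk x)).spanFinrank,
          Function.Injective ι ∧ ∀ D, stalkIdeal D.1 x = Ideal.span {u (ι D)}) :
    HasSNC (G :: 𝓛) := by
  have htop : ∀ x : X, x ∉ (⊤ : X.IdealSheafData).support := fun x h => by
    have h' : x ∈ ((⊤ : X.IdealSheafData).support : Set X) := h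
    simp [Scheme.IdealSheafData.support_top] at h'
  intro x
  by_cases hx : x ∈ G.support
  · obtain ⟨hreg, u, hu, ι, hι, hD⟩ := hasSNC_cons_at_of_traces hX G hGhyp 𝓛 hL hsep htr x hx
    exact ⟨hreg, u, hu, ⟨ι, hι, hD⟩, fun h => absurd h (htop x)⟩
  · obtain ⟨hreg, u, hu, ι, hι, hD⟩ := hoff x hx
    -- off `V(G)` the members of `G :: 𝓛` through `x` are the members of `𝓛` through `x`
    have hmem : ∀ D : {D // D ∈ G :: 𝓛 ∧ x ∈ D.support}, D.1 ∈ 𝓛 := fun D => by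
      rcases List.mem_cons.mp D.2.1 with h | h
      · exact absurd (h ▸ D.2.2) hx
      · exact h
    let e : {D // D ∈ G :: 𝓛 ∧ x ∈ D.support} → {D // D ∈ 𝓛 ∧ x ∈ D.support} := fun D => ⟨D.1, hmem D, D.2.2⟩
    have he : Function.Injective e := fun D₁ D₂ h => by
      have h' : (e D₁).1 = (e D₂).1 := by rw [h]
      exact Subtype.ext h'
    exact ⟨hreg, u, hu, ⟨ι ∘ e, hι.comp he, fun D => hD (e D)⟩, fun h => absurd h (htop x)⟩

end Summit.ResolutionOfSingularities.ResolutionOfSingularities.Theorems.DepthMultiHost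

end
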